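import Literature.AlgebraicGeometry.Motives.HodgeLieWeightOneThetaCommutantBound
import Literature.AlgebraicGeometry.Motives.HodgeLieWeightOnePeirce
import Literature.AlgebraicGeometry.Motives.HodgeLieWeightOneThetaIdeal
import HarnessLib

/-!
# Weight one, `End_Hdg = ℚ`: if the minimal raising rank `r` satisfies `r ≤ 3` and `r < dim V^{1,0}`, then `Lie Hg ⊗ ℂ` is SIMPLE
# (the `Θ`-commutant ideal vanishes; Moonen–Zarhin 1999 (2.3), Deligne I §3)

Family `hodge`, layer `Literature/AlgebraicGeometry/Motives`; THEOREMS ONLY (no definition, no named fact; D-0026).  Written for the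
cell `pub-hodgeav-hg6` (LADDER-HodgeAV row 2, TABLE X row 1 `g6.I(1)`: brick N9 of the row-1 programme «`End⁰ = ℚ`, `g = 6` ⟹
`Hg = Sp₁₂`», whose remaining crux after `HodgeLieWeightOneRankTwelveReduction` is a minimal raising tripotent of rank `r ∈ {2, 3, 4}`;
honest framing of that cell: HC / HC_AV / HC_CM NOT proved — unconditional Hodge–Lie linear algebra; this file does NOT exclude
`r ∈ {2, 3}`, it shows that in those cases `Lie Hg ⊗ ℂ` has no proper ideal, excluding the product configuration `𝔰𝔭₄ ⊕ 𝔰𝔬₃`).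

* §1 **`WeightOnePeirce.stable_of_forall_peirceOne_eq_zero`** — (`𝔊 ⊆ 𝔥_ℂ` bracket-closed ∋ `Θ`, conjugation-stable; `B, C = B̄` a
  tripotent pair `B C B = t B`) if EVERY raising `x ∈ 𝔊` has zero Peirce-`1` component, `range B ⊔ range C` is `𝔊`-stable (the
  stability half of `WeightOnePeirce.stable_or_three_mul_rank_le`, exported); **`…exists_peirceOne`** — hence, if `V_ℂ` is
  `𝔊`-irreducible and `rank B < dim V^{1,0}`, there is a non-zero raising `y ∈ 𝔊` which IS its own Peirce-`1` component
  (`E y F = 0`, `E y + y F = y`), in particular `y ∉ ℂ B`.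
* §2 **`hodgeLieC_simple_of_minimal_rank_le_three`** — `H` effective polarized of weight `1`, `End_Hdg = ℚ`, `B ∈ 𝔥_ℂ` raising,
  non-zero, of minimal rank `r ≤ 3` with `r < dim V^{1,0}`: every non-zero `ad 𝔥_ℂ`-stable subspace of `𝔥_ℂ` is `𝔥_ℂ`.  PROOF: take
  N2's splitting `𝔥_ℂ = 𝔰₁ ⊕ 𝔠` (`exists_thetaIdeal_of_forall_endAlg_eq_smul`); `B ∈ 𝔰₁` commutes with `𝔠`, so `dim 𝔠 ≤ r(r−1)/2 ≤ 3`
  (N8 `WeightOneCommutant.finrank_le_card`); `𝔰₁ ∋ B, y, B̄, [B, B̄]` are independent (`Θ`-grading), so `dim 𝔰₁ ≥ 4`; N2's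
  Jacobson clause (`𝔠 = 0` or `𝔠` contains an ideal of dimension `dim 𝔰₁`) leaves `𝔠 = 0`, and `𝔰₁ = 𝔥_ℂ` is minimal.

## References

* [MoonenZarhin1999LowDim] B. Moonen, Yu. Zarhin, *Hodge classes on abelian varieties of low dimension*, Math. Ann. 315 (1999),
  §2 (2.3)–(2.5), §3 (3.1).
* [Deligne1982HodgeCycles] P. Deligne, *Hodge cycles on abelian varieties*, LNM 900 (1982), I §3 (Prop. 3.4, 3.6, Example 3.7).
* [Jacobson1962LieAlgebras] N. Jacobson, *Lie algebras* (1962), Ch. X §1.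
-/

noncomputable section

open scoped TensorProduct

namespace Literature.AlgebraicGeometry.Motives

namespace HodgeStructure

universe u

variable {V : Type u} [AddCommGroup V] [Module ℚ V] [Module.Finite ℚ V] [HodgeTensorFacts.{u, u}] {n : ℤ}

/-! ## §1 Stability when all Peirce-`1` components vanish; existence of a Peirce-`1` element -/

omit [Module.Finite ℚ V] [HodgeTensorFacts.{u, u}] in
set_option maxHeartbeats 1600000 in
/-- **If every raising element of `𝔊` has zero Peirce-`1` component, `range B ⊔ range B̄` is `𝔊`-stable** (`B C B = t B` a tripotent
pair in the bracket-closed, `Θ`-containing, conjugation-stable `𝔊 ⊆ 𝔥_ℂ`). [cite: MoonenZarhin1999LowDim, §2 (2.3)–(2.5)]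
[cite: Deligne1982HodgeCycles, I §3 Prop. 3.4, Prop. 3.6] -/
theorem WeightOnePeirce.stable_of_forall_peirceOne_eq_zero (H : HodgeStructure V n) (hn : n = 1)
    (heff : H.IsEffective) {Θ : Module.End ℂ (ℂ ⊗[ℚ] V)} (hΘ : ∀ p, ∀ x ∈ H.piece p (n - p), Θ x = ((2 * p - n : ℤ) : ℂ) • x)
    {𝔊 : Submodule ℂ (Module.End ℂ (ℂ ⊗[ℚ] V))} (hbr : ∀ Y ∈ 𝔊, ∀ Z ∈ 𝔊, Y * Z - Z * Y ∈ 𝔊)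
    (hΘ𝔊 : Θ ∈ 𝔊) (hconj : ∀ Z ∈ 𝔊, ∀ Z' : Module.End ℂ (ℂ ⊗[ℚ] V), (∀ v, Z' v = conj (Z (conj v))) → Z' ∈ 𝔊)
    {B C : Module.End ℂ (ℂ ⊗[ℚ] V)} (hB : B ∈ 𝔊) (hB0 : B ≠ 0) (hBP : ∀ p ∈ H.piece 1 0, B p = 0)
    (hBim : ∀ v, B v ∈ H.piece 1 0) (hC : ∀ v, C v = conj (B (conj v))) {t : ℂ} (ht : t ≠ 0) (hBCB : B * C * B = t • B)
    (hzero : ∀ x ∈ 𝔊, (∀ p ∈ H.piece 1 0, x p = 0) → (∀ v, x v ∈ H.piece 1 0) →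
      t⁻¹ • (B * C) * x + x * (t⁻¹ • (C * B)) - (2 : ℂ) • (t⁻¹ • (B * C) * x * (t⁻¹ • (C * B))) = 0) :
    ∀ Z ∈ 𝔊, ∀ s ∈ LinearMap.range B ⊔ LinearMap.range C, Z s ∈ LinearMap.range B ⊔ LinearMap.range C := by
  classical
  obtain ⟨hCBC, -⟩ := WeightOnePeirce.conjOp_mul_conjOp_mul hC ht hB0 hBCB
  subst hn
  obtain ⟨hPmem, hQmem, hΘ10, hΘ01, hΘΘ⟩ := UnitaryTheta.theta_facts H rfl heff hΘ
  obtain ⟨hCQ, hCim, hcC, hcB⟩ := SymplecticThetaTen.conjOp_raise (P := H.piece 1 0) (Q := H.piece 0 1)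
    (fun x hx => conj_mem_piece H hx) (fun x hx => conj_mem_piece H hx) hBP hBim hC
  have hTfix : ∀ x : ℂ ⊗[ℚ] V, Θ x = x → x ∈ H.piece 1 0 := fun x hx => by
    have h := hPmem x
    rwa [hx, ← two_smul ℂ x, smul_smul, inv_mul_cancel₀ (two_ne_zero' ℂ), one_smul] at h
  have hTneg : ∀ x : ℂ ⊗[ℚ] V, Θ x = -x → x ∈ H.piece 0 1 := fun x hx => by
    have h := hQmem x
    rwa [hx, sub_neg_eq_add, ← two_smul ℂ x, smul_smul, inv_mul_cancel₀ (two_ne_zero' ℂ), one_smul] at h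
  have hBB : B * B = 0 := LinearMap.ext fun v => by
    rw [Module.End.mul_apply, hBP _ (hBim v), LinearMap.zero_apply]
  have hCC : C * C = 0 := LinearMap.ext fun v => by
    rw [Module.End.mul_apply, hCQ _ (hCim v), LinearMap.zero_apply]
  obtain ⟨E, hE⟩ : ∃ E : Module.End ℂ (ℂ ⊗[ℚ] V), E = t⁻¹ • (B * C) := ⟨_, rfl⟩
  obtain ⟨F, hF⟩ : ∃ F : Module.End ℂ (ℂ ⊗[ℚ] V), F = t⁻¹ • (C * B) := ⟨_, rfl⟩
  obtain ⟨-, -, hEB, -, hFC, -, -, -, -, -⟩ := WeightOnePeirce.tripotent_facts ht hBCB hCBC hBB hCC hE hF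
  have hEP : ∀ v, E v ∈ H.piece 1 0 := fun v => by
    rw [hE, LinearMap.smul_apply, Module.End.mul_apply]
    exact Submodule.smul_mem _ _ (hBim _)
  have hFP : ∀ p ∈ H.piece 1 0, F p = 0 := fun p hp => by
    rw [hF, LinearMap.smul_apply, Module.End.mul_apply, hBP p hp, map_zero, smul_zero]
  have hBle : LinearMap.range B ≤ H.piece 1 0 := by
    rintro _ ⟨w, rfl⟩
    exact hBim w
  have hex : ∀ x ∈ 𝔊, (∀ p ∈ H.piece 1 0, x p = 0) → (∀ v, x v ∈ H.piece 1 0) →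
      E * x + x * F - (2 : ℂ) • (E * x * F) = 0 := fun x hx hxP hxim => by
    rw [hE, hF]
    exact hzero x hx hxP hxim
  have hR : ∀ x ∈ 𝔊, (∀ p ∈ H.piece 1 0, x p = 0) → (∀ v, x v ∈ H.piece 1 0) →
      ∀ v, x (C v) ∈ LinearMap.range B := fun x hx hxP hxim v =>
    WeightOnePeirce.apply_mem_range_of_raising ht hBCB hCBC hBB hCC hE hF (hex x hx hxP hxim) v
  have hL : ∀ l ∈ 𝔊, (∀ p ∈ H.piece 1 0, l p ∈ H.piece 1 0) → ∀ v, l (B v) ∈ LinearMap.range B := by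
    intro l hl hlP v
    have hx : l * B - B * l ∈ 𝔊 := hbr l hl B hB
    have hxP : ∀ p ∈ H.piece 1 0, (l * B - B * l) p = 0 := fun p hp => by
      rw [LinearMap.sub_apply, Module.End.mul_apply, Module.End.mul_apply, hBP p hp, map_zero, hBP _ (hlP p hp),
        sub_zero]
    have hxim : ∀ v, (l * B - B * l) v ∈ H.piece 1 0 := fun v => by
      rw [LinearMap.sub_apply, Module.End.mul_apply, Module.End.mul_apply]
      exact Submodule.sub_mem _ (hlP _ (hBim v)) (hBim _)
    exact WeightOnePeirce.apply_mem_range_of_levi ht hBCB hCBC hBB hCC hE hF (hex _ hx hxP hxim) v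
  -- the lowering and conjugate-Levi versions, by conjugation
  have hR' : ∀ y ∈ 𝔊, (∀ q ∈ H.piece 0 1, y q = 0) → (∀ v, y v ∈ H.piece 0 1) →
      ∀ v, y (B v) ∈ LinearMap.range C := by
    intro y hy hyQ hyim v
    obtain ⟨yb, hyb⟩ := exists_conjOp y
    have hybmem : yb ∈ 𝔊 := hconj y hy yb hyb
    have hybP : ∀ p ∈ H.piece 1 0, yb p = 0 := fun p hp => by
      rw [hyb, hyQ _ (conj_mem_piece H hp), map_zero]
    have hybim : ∀ v, yb v ∈ H.piece 1 0 := fun v => by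
      rw [hyb]
      exact conj_mem_piece H (hyim _)
    obtain ⟨w, hw⟩ := LinearMap.mem_range.1 (hR yb hybmem hybP hybim (conj v))
    have h : y (B v) = conj (yb (conj (B v))) := by rw [hyb, conj_conj, conj_conj]
    rw [h, hcB, ← hw, hcB]
    exact LinearMap.mem_range_self C _
  have hL' : ∀ l ∈ 𝔊, (∀ q ∈ H.piece 0 1, l q ∈ H.piece 0 1) → ∀ v, l (C v) ∈ LinearMap.range C := by
    intro l hl hlQ v
    obtain ⟨lb, hlb⟩ := exists_conjOp l
    have hlbmem : lb ∈ 𝔊 := hconj l hl lb hlb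
    have hlbP : ∀ p ∈ H.piece 1 0, lb p ∈ H.piece 1 0 := fun p hp => by
      rw [hlb]
      exact conj_mem_piece H (hlQ _ (conj_mem_piece H hp))
    obtain ⟨w, hw⟩ := LinearMap.mem_range.1 (hL lb hlbmem hlbP (conj v))
    have h : l (C v) = conj (lb (conj (C v))) := by rw [hlb, conj_conj, conj_conj]
    rw [h, hcC, ← hw, hcB]
    exact LinearMap.mem_range_self C _
  -- decomposition `Z = Z⁺ + Z⁻ + Z⁰`
  intro Z hZ s hs
  obtain ⟨Zp, hZp⟩ : ∃ Zp : Module.End ℂ (ℂ ⊗[ℚ] V), Zp = (4 : ℂ)⁻¹ • (Z + Θ * Z - Z * Θ - Θ * Z * Θ) := ⟨_, rfl⟩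
  obtain ⟨Zm, hZm⟩ : ∃ Zm : Module.End ℂ (ℂ ⊗[ℚ] V),
      Zm = (4 : ℂ)⁻¹ • (Z + (-Θ) * Z - Z * (-Θ) - (-Θ) * Z * (-Θ)) := ⟨_, rfl⟩
  have hΘΘ' : ∀ v, (-Θ) ((-Θ) v) = v := fun v => by
    rw [LinearMap.neg_apply, LinearMap.neg_apply, map_neg, neg_neg, hΘΘ]
  have hZpmem : Zp ∈ 𝔊 := hZp ▸ UnitaryTheta.raise_mem hbr hΘ𝔊 hΘΘ hZ
  have hZmmem : Zm ∈ 𝔊 := hZm ▸ UnitaryTheta.raise_mem hbr (Submodule.neg_mem _ hΘ𝔊) hΘΘ' hZ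
  have hZpP : ∀ p ∈ H.piece 1 0, Zp p = 0 := fun p hp => by
    rw [hZp]
    exact UnitaryTheta.raise_apply_of_eq Θ Z (hΘ10 p hp)
  have hZpim : ∀ v, Zp v ∈ H.piece 1 0 := fun v => hTfix _ (by
    rw [hZp]
    exact UnitaryTheta.apply_raise_apply hΘΘ Z v)
  have hZmQ : ∀ q ∈ H.piece 0 1, Zm q = 0 := fun q hq => by
    rw [hZm]
    exact UnitaryTheta.raise_apply_of_eq (-Θ) Z (by rw [LinearMap.neg_apply, hΘ01 q hq, neg_neg])
  have hZmim : ∀ v, Zm v ∈ H.piece 0 1 := fun v => hTneg _ (by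
    have h := UnitaryTheta.apply_raise_apply hΘΘ' Z v
    rw [LinearMap.neg_apply, neg_eq_iff_eq_neg] at h
    rw [hZm]
    exact h)
  obtain ⟨Z0, hZ0⟩ : ∃ Z0 : Module.End ℂ (ℂ ⊗[ℚ] V), Z0 = Z - Zp - Zm := ⟨_, rfl⟩
  have hZ0mem : Z0 ∈ 𝔊 := hZ0 ▸ Submodule.sub_mem _ (Submodule.sub_mem _ hZ hZpmem) hZmmem
  have hΘ2 : Θ * Θ = 1 := LinearMap.ext fun v => by rw [Module.End.mul_apply, hΘΘ, Module.End.one_apply]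
  have h1 : (-Θ) * Z = -(Θ * Z) := LinearMap.ext fun v => by simp only [Module.End.mul_apply, LinearMap.neg_apply]
  have h2 : Z * (-Θ) = -(Z * Θ) := LinearMap.ext fun v => by
    simp only [Module.End.mul_apply, LinearMap.neg_apply, map_neg]
  have h3 : (-Θ) * Z * (-Θ) = Θ * Z * Θ := LinearMap.ext fun v => by
    simp only [Module.End.mul_apply, LinearMap.neg_apply, map_neg, neg_neg]
  have hZ0eq : Z0 = (2 : ℂ)⁻¹ • (Z + Θ * Z * Θ) := by
    rw [hZ0, hZp, hZm, h3, h1, h2]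
    module
  have hcomm : Θ * Z0 = Z0 * Θ := by
    rw [hZ0eq, mul_smul_comm, smul_mul_assoc, mul_add, add_mul, show Θ * (Θ * Z * Θ) = (Θ * Θ) * Z * Θ by
      simp only [mul_assoc], mul_assoc (Θ * Z) Θ Θ, hΘ2, one_mul, mul_one, add_comm]
  have hZ0P : ∀ p ∈ H.piece 1 0, Z0 p ∈ H.piece 1 0 := fun p hp => hTfix _ (by
    rw [← Module.End.mul_apply, hcomm, Module.End.mul_apply, hΘ10 p hp])
  have hZ0Q : ∀ q ∈ H.piece 0 1, Z0 q ∈ H.piece 0 1 := fun q hq => hTneg _ (by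
    rw [← Module.End.mul_apply, hcomm, Module.End.mul_apply, hΘ01 q hq, map_neg])
  have hZsum : Z = Zp + Zm + Z0 := by rw [hZ0]; abel
  obtain ⟨u, hu, w, hw, rfl⟩ := Submodule.mem_sup.1 hs
  obtain ⟨u', rfl⟩ := LinearMap.mem_range.1 hu
  obtain ⟨w', rfl⟩ := LinearMap.mem_range.1 hw
  have h1S : Zp (C w') ∈ LinearMap.range B ⊔ LinearMap.range C :=
    Submodule.mem_sup_left (hR Zp hZpmem hZpP hZpim w')
  have h2S : Zm (B u') ∈ LinearMap.range B ⊔ LinearMap.range C :=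
    Submodule.mem_sup_right (hR' Zm hZmmem hZmQ hZmim u')
  have h3S : Z0 (B u') ∈ LinearMap.range B ⊔ LinearMap.range C := Submodule.mem_sup_left (hL Z0 hZ0mem hZ0P u')
  have h4S : Z0 (C w') ∈ LinearMap.range B ⊔ LinearMap.range C := Submodule.mem_sup_right (hL' Z0 hZ0mem hZ0Q w')
  have h5S : Zp (B u') ∈ LinearMap.range B ⊔ LinearMap.range C := by
    rw [hZpP _ (hBim u')]
    exact Submodule.zero_mem _
  have h6S : Zm (C w') ∈ LinearMap.range B ⊔ LinearMap.range C := by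
    rw [hZmQ _ (hCim w')]
    exact Submodule.zero_mem _
  rw [hZsum]
  simp only [LinearMap.add_apply, map_add]
  apply_rules [Submodule.add_mem]

omit [HodgeTensorFacts.{u, u}] in
set_option maxHeartbeats 1600000 in
/-- **A Peirce-`1` element exists when `rank B < dim V^{1,0}`** (`V_ℂ` irreducible under `𝔊`): there is a raising `y ∈ 𝔊`, `y ≠ 0`,
equal to its own Peirce-`1` component (`E y + y F − 2 E y F = y`), hence not a multiple of `B`.
[cite: MoonenZarhin1999LowDim, §2 (2.3)–(2.5)] [cite: Deligne1982HodgeCycles, I §3 Prop. 3.4, Prop. 3.6] -/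
theorem WeightOnePeirce.exists_peirceOne (H : HodgeStructure V n) (hn : n = 1)
    (heff : H.IsEffective) {Θ : Module.End ℂ (ℂ ⊗[ℚ] V)} (hΘ : ∀ p, ∀ x ∈ H.piece p (n - p), Θ x = ((2 * p - n : ℤ) : ℂ) • x)
    {𝔊 : Submodule ℂ (Module.End ℂ (ℂ ⊗[ℚ] V))} (hbr : ∀ Y ∈ 𝔊, ∀ Z ∈ 𝔊, Y * Z - Z * Y ∈ 𝔊)
    (hΘ𝔊 : Θ ∈ 𝔊) (hconj : ∀ Z ∈ 𝔊, ∀ Z' : Module.End ℂ (ℂ ⊗[ℚ] V), (∀ v, Z' v = conj (Z (conj v))) → Z' ∈ 𝔊)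
    (hirr : ∀ U : Submodule ℂ (ℂ ⊗[ℚ] V), (∀ Z ∈ 𝔊, ∀ u ∈ U, Z u ∈ U) → U = ⊥ ∨ U = ⊤)
    {B C : Module.End ℂ (ℂ ⊗[ℚ] V)} (hB : B ∈ 𝔊) (hB0 : B ≠ 0) (hBP : ∀ p ∈ H.piece 1 0, B p = 0)
    (hBim : ∀ v, B v ∈ H.piece 1 0) (hC : ∀ v, C v = conj (B (conj v))) {t : ℂ} (ht : t ≠ 0) (hBCB : B * C * B = t • B)
    (hrg : Module.finrank ℂ (LinearMap.range B) < Module.finrank ℂ (H.piece 1 0)) :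
    ∃ y ∈ 𝔊, y ≠ 0 ∧ (∀ p ∈ H.piece 1 0, y p = 0) ∧ (∀ v, y v ∈ H.piece 1 0) ∧
      t⁻¹ • (B * C) * y + y * (t⁻¹ • (C * B)) - (2 : ℂ) • (t⁻¹ • (B * C) * y * (t⁻¹ • (C * B))) = y ∧
      ∀ s : ℂ, y ≠ s • B := by
  classical
  obtain ⟨hCBC, -⟩ := WeightOnePeirce.conjOp_mul_conjOp_mul hC ht hB0 hBCB
  have hC𝔊 : C ∈ 𝔊 := hconj B hB C hC
  by_cases hzero : ∀ x ∈ 𝔊, (∀ p ∈ H.piece 1 0, x p = 0) → (∀ v, x v ∈ H.piece 1 0) →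
      t⁻¹ • (B * C) * x + x * (t⁻¹ • (C * B)) - (2 : ℂ) • (t⁻¹ • (B * C) * x * (t⁻¹ • (C * B))) = 0
  · -- all Peirce-1 components vanish: `range B ⊔ range C` is stable, hence everything, so `rank B = dim P`
    exfalso
    have hst := WeightOnePeirce.stable_of_forall_peirceOne_eq_zero H hn heff hΘ hbr hΘ𝔊 hconj hB hB0 hBP hBim hC ht hBCB hzero
    subst hn
    obtain ⟨hPmem, hQmem, hΘ10, hΘ01, -⟩ := UnitaryTheta.theta_facts H rfl heff hΘ
    obtain ⟨-, hCim, -, -⟩ := SymplecticThetaTen.conjOp_raise (P := H.piece 1 0) (Q := H.piece 0 1)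
      (fun x hx => conj_mem_piece H hx) (fun x hx => conj_mem_piece H hx) hBP hBim hC
    have hBle : LinearMap.range B ≤ H.piece 1 0 := by
      rintro _ ⟨w, rfl⟩
      exact hBim w
    have hCle : LinearMap.range C ≤ H.piece 0 1 := by
      rintro _ ⟨w, rfl⟩
      exact hCim w
    rcases hirr _ hst with hbot | htop
    · refine hB0 (LinearMap.ext fun v => ?_)
      have h : B v ∈ LinearMap.range B ⊔ LinearMap.range C := Submodule.mem_sup_left (LinearMap.mem_range_self B v)
      rw [hbot, Submodule.mem_bot] at h
      rw [h, LinearMap.zero_apply]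
    · have hPQ : ∀ v, (2 : ℂ)⁻¹ • (v + Θ v) + (2 : ℂ)⁻¹ • (v - Θ v) = v := fun v => by module
      have hsup : H.piece 1 0 ⊔ H.piece 0 1 = ⊤ := by
        rw [eq_top_iff]
        intro v _
        rw [← hPQ v]
        exact Submodule.add_mem_sup (hPmem v) (hQmem v)
      have hinf : H.piece 1 0 ⊓ H.piece 0 1 = ⊥ := by
        rw [eq_bot_iff]
        intro x hx
        rw [Submodule.mem_bot]
        have h1 := hΘ10 x hx.1
        rw [hΘ01 x hx.2, neg_eq_iff_add_eq_zero, ← two_smul ℂ x, smul_eq_zero] at h1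
        exact h1.resolve_left (two_ne_zero' ℂ)
      have hsum := Submodule.finrank_sup_add_finrank_inf_eq (H.piece 1 0) (H.piece 0 1)
      rw [hsup, hinf, finrank_top, finrank_bot, add_zero] at hsum
      have hsymm : Module.finrank ℂ (H.piece 1 0) = Module.finrank ℂ (H.piece 0 1) := hodgeNumber_symm_holds H 1 0
      have htop' := Submodule.finrank_add_le_finrank_add_finrank (LinearMap.range B) (LinearMap.range C)
      rw [htop, finrank_top] at htop'
      have h2 := Submodule.finrank_mono hCle
      omega
  · push Not at hzero
    obtain ⟨x, hx, hxP, hxim, hx1⟩ := hzero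
    subst hn
    obtain ⟨hCQ, hCim, -, -⟩ := SymplecticThetaTen.conjOp_raise (P := H.piece 1 0) (Q := H.piece 0 1)
      (fun x hx => conj_mem_piece H hx) (fun x hx => conj_mem_piece H hx) hBP hBim hC
    have hBB : B * B = 0 := LinearMap.ext fun v => by
      rw [Module.End.mul_apply, hBP _ (hBim v), LinearMap.zero_apply]
    have hCC : C * C = 0 := LinearMap.ext fun v => by
      rw [Module.End.mul_apply, hCQ _ (hCim v), LinearMap.zero_apply]
    obtain ⟨E, hE⟩ : ∃ E : Module.End ℂ (ℂ ⊗[ℚ] V), E = t⁻¹ • (B * C) := ⟨_, rfl⟩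
    obtain ⟨F, hF⟩ : ∃ F : Module.End ℂ (ℂ ⊗[ℚ] V), F = t⁻¹ • (C * B) := ⟨_, rfl⟩
    rw [← hE, ← hF] at hx1 ⊢
    obtain ⟨hEE, hFF, hEB, hBF, -, -, -, -, hEF, -⟩ := WeightOnePeirce.tripotent_facts ht hBCB hCBC hBB hCC hE hF
    have hEP : ∀ v, E v ∈ H.piece 1 0 := fun v => by
      rw [hE, LinearMap.smul_apply, Module.End.mul_apply]
      exact Submodule.smul_mem _ _ (hBim _)
    have hFP : ∀ p ∈ H.piece 1 0, F p = 0 := fun p hp => by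
      rw [hF, LinearMap.smul_apply, Module.End.mul_apply, hBP p hp, map_zero, smul_zero]
    have hxB : x * B = 0 := LinearMap.ext fun v => by
      rw [Module.End.mul_apply, hxP _ (hBim v), LinearMap.zero_apply]
    have hBx : B * x = 0 := LinearMap.ext fun v => by
      rw [Module.End.mul_apply, hBP _ (hxim v), LinearMap.zero_apply]
    obtain ⟨-, hx1mem⟩ := WeightOnePeirce.peirceOne_mem hbr ht hBCB hCBC hBB hCC hE hF hB hC𝔊 hx hxB hBx
    refine ⟨E * x + x * F - (2 : ℂ) • (E * x * F), hx1mem, hx1, fun p hp => ?_, fun v => ?_, ?_, fun s hs => ?_⟩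
    · simp only [LinearMap.sub_apply, LinearMap.add_apply, LinearMap.smul_apply, Module.End.mul_apply, hFP p hp,
        hxP p hp, map_zero, smul_zero, add_zero, sub_zero]
    · simp only [LinearMap.sub_apply, LinearMap.add_apply, LinearMap.smul_apply, Module.End.mul_apply]
      exact Submodule.sub_mem _ (Submodule.add_mem _ (hEP _) (hxim _)) (Submodule.smul_mem _ _ (hEP _))
    · -- the Peirce-1 projection is idempotent
      have h1 : E * (E * x + x * F - (2 : ℂ) • (E * x * F)) = E * x - E * x * F := by
        rw [mul_sub, mul_add, mul_smul_comm, ← mul_assoc E E x, hEE, ← mul_assoc E x F, ← mul_assoc E (E * x) F,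
          ← mul_assoc E E x, hEE, two_smul]
        abel
      have h2 : (E * x + x * F - (2 : ℂ) • (E * x * F)) * F = x * F - E * x * F := by
        rw [sub_mul, add_mul, smul_mul_assoc, mul_assoc x F F, hFF, mul_assoc (E * x) F F, hFF, two_smul]
        abel
      have h3 : E * (E * x + x * F - (2 : ℂ) • (E * x * F)) * F = 0 := by
        rw [h1, sub_mul, mul_assoc (E * x) F F, hFF, sub_self]
      rw [h3, h1, h2, smul_zero, sub_zero, two_smul]
      abel
    · -- not a multiple of `B`: the Peirce-1 component of `s B` is `0`
      apply hx1
      have h : E * (s • B) + (s • B) * F - (2 : ℂ) • (E * (s • B) * F) = 0 := by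
        simp only [mul_smul_comm, smul_mul_assoc, hEB, hBF]
        module
      -- `x₁ = (x₁)₁ = (sB)₁ = 0`
      have h1 : E * (E * x + x * F - (2 : ℂ) • (E * x * F)) = E * x - E * x * F := by
        rw [mul_sub, mul_add, mul_smul_comm, ← mul_assoc E E x, hEE, ← mul_assoc E x F, ← mul_assoc E (E * x) F,
          ← mul_assoc E E x, hEE, two_smul]
        abel
      have h2 : (E * x + x * F - (2 : ℂ) • (E * x * F)) * F = x * F - E * x * F := by
        rw [sub_mul, add_mul, smul_mul_assoc, mul_assoc x F F, hFF, mul_assoc (E * x) F F, hFF, two_smul]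
        abel
      have h3 : E * (E * x + x * F - (2 : ℂ) • (E * x * F)) * F = 0 := by
        rw [h1, sub_mul, mul_assoc (E * x) F F, hFF, sub_self]
      have hidem : E * (E * x + x * F - (2 : ℂ) • (E * x * F)) + (E * x + x * F - (2 : ℂ) • (E * x * F)) * F -
          (2 : ℂ) • (E * (E * x + x * F - (2 : ℂ) • (E * x * F)) * F) = E * x + x * F - (2 : ℂ) • (E * x * F) := by
        rw [h3, h1, h2, smul_zero, sub_zero, two_smul]
        abel
      rw [← hidem, hs, h]

/-! ## §2 `End_Hdg = ℚ`, minimal raising rank `r ≤ 3`, `r < dim V^{1,0}`: `Lie Hg ⊗ ℂ` is simple -/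

set_option maxHeartbeats 3200000 in
/-- **`Lie Hg ⊗ ℂ` is simple when the minimal raising rank is `≤ 3` and `< dim V^{1,0}`** (`H` effective polarized of weight `1`,
`End_Hdg = ℚ`): every non-zero `ad 𝔥_ℂ`-stable subspace of `𝔥_ℂ` is `𝔥_ℂ` — the `Θ`-commutant ideal `𝔠` of N2's splitting has
`dim 𝔠 ≤ 3 < 4 ≤ dim 𝔰₁`, so the Jacobson clause forces `𝔠 = 0`. [cite: MoonenZarhin1999LowDim, §2 (2.3)–(2.5) and §3 (3.1)]
[cite: Deligne1982HodgeCycles, I §3 Prop. 3.4, Prop. 3.6, Example 3.7] [cite: Jacobson1962LieAlgebras, Ch. X §1 Theorems 1–3] -/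
theorem hodgeLieC_simple_of_minimal_rank_le_three [Nontrivial V] (H : HodgeStructure V n) (ψ : H.Polarization)
    (hn : n = 1) (heff : H.IsEffective) (hE : ∀ a ∈ H.endAlg, ∃ x : ℚ, a = x • (1 : Module.End ℚ V))
    {B C : Module.End ℂ (ℂ ⊗[ℚ] V)} (hB : B ∈ H.hodgeLieC) (hB0 : B ≠ 0) (hBP : ∀ p ∈ H.piece 1 0, B p = 0)
    (hBim : ∀ v, B v ∈ H.piece 1 0) (hC : ∀ v, C v = conj (B (conj v)))
    (hmin : ∀ B' ∈ H.hodgeLieC, B' ≠ 0 → (∀ p ∈ H.piece 1 0, B' p = 0) → (∀ v, B' v ∈ H.piece 1 0) →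
      Module.finrank ℂ (LinearMap.range B) ≤ Module.finrank ℂ (LinearMap.range B'))
    (hr3 : Module.finrank ℂ (LinearMap.range B) ≤ 3)
    (hrg : Module.finrank ℂ (LinearMap.range B) < Module.finrank ℂ (H.piece 1 0)) :
    ∀ T : Submodule ℂ (Module.End ℂ (ℂ ⊗[ℚ] V)), T ≤ H.hodgeLieC → T ≠ ⊥ →
      (∀ Y ∈ H.hodgeLieC, ∀ t ∈ T, Y * t - t * Y ∈ T) → T = H.hodgeLieC := by
  classical
  obtain ⟨hbr, hskew, -, Θ, hΘ, hΘ𝔤⟩ := hodgeLie_standing H ψ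
  have hspan : H.hodgeLieC = spanC H.hodgeLie := hodgeLieC_eq_spanC H
  have hΘC : Θ ∈ H.hodgeLieC := by rw [hspan]; exact hΘ𝔤
  have hbrC : ∀ Y ∈ H.hodgeLieC, ∀ Z ∈ H.hodgeLieC, Y * Z - Z * Y ∈ H.hodgeLieC := fun Y hY Z hZ => by
    rw [hspan] at hY hZ ⊢
    exact commutator_mem_spanC hbr hY hZ
  have hconj : ∀ Z ∈ H.hodgeLieC, ∀ Z' : Module.End ℂ (ℂ ⊗[ℚ] V), (∀ v, Z' v = conj (Z (conj v))) →
      Z' ∈ H.hodgeLieC := fun Z hZ Z' hZ' => by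
    rw [hspan] at hZ ⊢
    exact conjOp_mem_spanC hZ hZ'
  have hirr : ∀ U : Submodule ℂ (ℂ ⊗[ℚ] V), (∀ Z ∈ H.hodgeLieC, ∀ u ∈ U, Z u ∈ U) → U = ⊥ ∨ U = ⊤ :=
    fun U hU => SymplecticTheta.eq_bot_or_top_of_stable H hn heff ψ hE H.hodgeLie hΘ hΘ𝔤 hskew
      fun X hX u hu => hU _ (by rw [hspan]; exact baseChange_mem_spanC hX) u hu
  have hC𝔊 : C ∈ H.hodgeLieC := hconj B hB C hC
  obtain ⟨t, ht, hBCB⟩ :=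
    WeightOneMinimalRaising.mul_conjOp_mul_eq_smul H ψ hn heff hΘ le_rfl hbrC hB hB0 hBP hBim hC hC𝔊 hmin
  obtain ⟨𝔰₁, 𝔠, -, h𝔠, -, hsup, had𝔰, had𝔠, hcomm, -, hmin𝔰, -, hraise, hlower, hΘ𝔠, hclause⟩ :=
    exists_thetaIdeal_of_forall_endAlg_eq_smul H ψ hn heff hE hΘ
  have hB𝔰 : B ∈ 𝔰₁ := hraise B hB hBP hBim
  -- `dim 𝔠 ≤ 3`
  have hsplit : ∀ Z ∈ H.hodgeLieC, ∃ s z : Module.End ℂ (ℂ ⊗[ℚ] V), Z = s + z ∧ z ∈ 𝔠 ∧ ∀ c ∈ 𝔠, s * c = c * s :=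
    fun Z hZ => by
      rw [← hsup] at hZ
      obtain ⟨s, hs, z, hz, rfl⟩ := Submodule.mem_sup.1 hZ
      exact ⟨s, z, rfl, hz, fun c hc => hcomm s hs c hc⟩
  have hcB : ∀ c ∈ 𝔠, c * B = B * c := fun c hc => (hcomm B hB𝔰 c hc).symm
  obtain ⟨r, hr⟩ : ∃ r, Module.finrank ℂ (LinearMap.range B) = r := ⟨_, rfl⟩
  have h𝔠dim := WeightOneCommutant.finrank_le_card H ψ hn heff hΘ hirr h𝔠 had𝔠 hsplit hΘ𝔠 hB hB0 hBP hBim hcB hr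
  have h𝔠3 : Module.finrank ℂ 𝔠 ≤ 3 := by
    rw [hr] at hr3
    interval_cases r
    · exact h𝔠dim.trans (by decide)
    · exact h𝔠dim.trans (by decide)
    · exact h𝔠dim.trans (by decide)
    · exact h𝔠dim.trans (by decide)
  -- a Peirce-1 element `y`, and the four independent elements `B, y, C, [B, C]` of `𝔰₁`
  obtain ⟨y, hy, hy0, hyP, hyim, -, hyB⟩ :=
    WeightOnePeirce.exists_peirceOne H hn heff hΘ hbrC hΘC hconj hirr hB hB0 hBP hBim hC ht hBCB hrg
  have hy𝔰 : y ∈ 𝔰₁ := hraise y hy hyP hyim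
  subst hn
  obtain ⟨hPmem, hQmem, hΘ10, hΘ01, hΘΘ⟩ := UnitaryTheta.theta_facts H rfl heff hΘ
  obtain ⟨hCQ, hCim, -, -⟩ := SymplecticThetaTen.conjOp_raise (P := H.piece 1 0) (Q := H.piece 0 1)
    (fun x hx => conj_mem_piece H hx) (fun x hx => conj_mem_piece H hx) hBP hBim hC
  have hC𝔰 : C ∈ 𝔰₁ := hlower C hC𝔊 hCQ hCim
  have hL𝔰 : B * C - C * B ∈ 𝔰₁ := had𝔰 B hB C hC𝔰
  have hPQ : ∀ v : ℂ ⊗[ℚ] V, (2 : ℂ)⁻¹ • (v + Θ v) + (2 : ℂ)⁻¹ • (v - Θ v) = v := fun v => by module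
  have hrais : ∀ X : Module.End ℂ (ℂ ⊗[ℚ] V), (∀ p ∈ H.piece 1 0, X p = 0) → (∀ v, X v ∈ H.piece 1 0) →
      Θ * X = X ∧ X * Θ = -X := fun X hXP hXim => by
    refine ⟨LinearMap.ext fun v => ?_, LinearMap.ext fun v => ?_⟩
    · rw [Module.End.mul_apply, hΘ10 _ (hXim v)]
    · rw [Module.End.mul_apply, LinearMap.neg_apply]
      conv_lhs => rw [← hPQ v, map_add, hΘ10 _ (hPmem v), hΘ01 _ (hQmem v), map_add, map_neg, hXP _ (hPmem v), zero_add]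
      conv_rhs => rw [← hPQ v, map_add, hXP _ (hPmem v), zero_add]
  have hlow : Θ * C = -C ∧ C * Θ = C := by
    refine ⟨LinearMap.ext fun v => ?_, LinearMap.ext fun v => ?_⟩
    · rw [Module.End.mul_apply, LinearMap.neg_apply, hΘ01 _ (hCim v)]
    · rw [Module.End.mul_apply]
      conv_lhs => rw [← hPQ v, map_add, hΘ10 _ (hPmem v), hΘ01 _ (hQmem v), map_add, map_neg, hCQ _ (hQmem v),
        neg_zero, add_zero]
      conv_rhs => rw [← hPQ v, map_add, hCQ _ (hQmem v), add_zero]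
  obtain ⟨hΘB, hBΘ⟩ := hrais B hBP hBim
  obtain ⟨hΘy, hyΘ⟩ := hrais y hyP hyim
  obtain ⟨hΘC', hCΘ⟩ := hlow
  have hΘL : Θ * (B * C - C * B) = (B * C - C * B) * Θ := by
    rw [mul_sub, sub_mul, ← mul_assoc, ← mul_assoc, hΘB, hΘC', mul_assoc B C Θ, hCΘ, mul_assoc C B Θ, hBΘ,
      show (-C) * B = -(C * B) from neg_mul C B, show C * (-B) = -(C * B) from mul_neg C B]
  have hC0 : C ≠ 0 := fun h => by
    rw [h, mul_zero, zero_mul] at hBCB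
    exact hB0 ((smul_eq_zero.1 hBCB.symm).resolve_left ht)
  have hL0 : B * C - C * B ≠ 0 := fun h => by
    have hBC : B * C = C * B := sub_eq_zero.1 h
    have hBB : B * B = 0 := LinearMap.ext fun v => by rw [Module.End.mul_apply, hBP _ (hBim v), LinearMap.zero_apply]
    rw [hBC, mul_assoc, hBB, mul_zero] at hBCB
    exact hB0 ((smul_eq_zero.1 hBCB.symm).resolve_left ht)
  -- linear independence of `B, y, C, [B, C]`
  have hindep : ∀ g₀ g₁ g₂ g₃ : ℂ, g₀ • B + g₁ • y + g₂ • C + g₃ • (B * C - C * B) = 0 →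
      g₀ = 0 ∧ g₁ = 0 ∧ g₂ = 0 ∧ g₃ = 0 := by
    intro g₀ g₁ g₂ g₃ hsum
    have E1 : g₀ • B + g₁ • y + (-g₂) • C + g₃ • (Θ * (B * C - C * B)) = 0 := by
      have h := congrArg (fun X => Θ * X) hsum
      simp only [mul_add, mul_smul_comm, hΘB, hΘy, hΘC', mul_zero] at h
      rw [← h]
      module
    have E2 : (-g₀) • B + (-g₁) • y + g₂ • C + g₃ • (Θ * (B * C - C * B)) = 0 := by
      have h := congrArg (fun X => X * Θ) hsum
      simp only [add_mul, smul_mul_assoc, hBΘ, hyΘ, hCΘ, zero_mul, ← hΘL] at h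
      rw [← h]
      module
    have E3 : g₀ • B + g₁ • y - g₂ • C = 0 := by
      have h : (g₀ • B + g₁ • y + (-g₂) • C + g₃ • (Θ * (B * C - C * B))) -
          ((-g₀) • B + (-g₁) • y + g₂ • C + g₃ • (Θ * (B * C - C * B))) = 0 := by rw [E1, E2, sub_zero]
      have h2 : (2 : ℂ) • (g₀ • B + g₁ • y - g₂ • C) = 0 := by rw [← h]; module
      exact (smul_eq_zero.1 h2).resolve_left (two_ne_zero' ℂ)
    have E4 : g₀ • B + g₁ • y + g₂ • C = 0 := by
      have h := congrArg (fun X => Θ * X) E3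
      simp only [mul_add, mul_sub, mul_smul_comm, hΘB, hΘy, hΘC', mul_zero] at h
      rw [← h]
      module
    have E5 : g₀ • B + g₁ • y = 0 := by
      have h2 : (2 : ℂ) • (g₀ • B + g₁ • y) = 0 := by
        rw [show (2 : ℂ) • (g₀ • B + g₁ • y) = (g₀ • B + g₁ • y - g₂ • C) + (g₀ • B + g₁ • y + g₂ • C) by module, E3,
          E4, add_zero]
      exact (smul_eq_zero.1 h2).resolve_left (two_ne_zero' ℂ)
    have E6 : g₂ • C = 0 := by
      have h2 : (2 : ℂ) • (g₂ • C) = 0 := by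
        rw [show (2 : ℂ) • (g₂ • C) = (g₀ • B + g₁ • y + g₂ • C) - (g₀ • B + g₁ • y - g₂ • C) by module, E3, E4,
          sub_zero]
      exact (smul_eq_zero.1 h2).resolve_left (two_ne_zero' ℂ)
    have hg₁ : g₁ = 0 := by
      by_contra hne
      refine hyB (-(g₁⁻¹ * g₀)) ?_
      have h : y = g₁⁻¹ • (g₀ • B + g₁ • y) - (g₁⁻¹ * g₀) • B := by
        rw [smul_add, smul_smul, smul_smul, inv_mul_cancel₀ hne, one_smul]
        abel
      rw [h, E5, smul_zero, zero_sub]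
      exact (neg_smul _ _).symm
    have hg₀ : g₀ = 0 := by
      rw [hg₁, zero_smul, add_zero] at E5
      exact (smul_eq_zero.1 E5).resolve_right hB0
    have hg₂ : g₂ = 0 := (smul_eq_zero.1 E6).resolve_right hC0
    have hg₃ : g₃ = 0 := by
      rw [hg₀, hg₁, hg₂, zero_smul, zero_smul, zero_smul, zero_add, zero_add, zero_add] at hsum
      exact (smul_eq_zero.1 hsum).resolve_right hL0
    exact ⟨hg₀, hg₁, hg₂, hg₃⟩
  have hli : LinearIndependent ℂ ![B, y, C, B * C - C * B] := by
    rw [Fintype.linearIndependent_iff]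
    intro g hg
    rw [Fin.sum_univ_four] at hg
    simp only [Matrix.cons_val_zero, Matrix.cons_val_one, Matrix.cons_val] at hg
    obtain ⟨h0, h1, h2, h3⟩ := hindep (g 0) (g 1) (g 2) (g 3) hg
    intro i
    fin_cases i
    · exact h0
    · exact h1
    · exact h2
    · exact h3
  have h𝔰4 : 4 ≤ Module.finrank ℂ 𝔰₁ := by
    have hle : Submodule.span ℂ (Set.range ![B, y, C, B * C - C * B]) ≤ 𝔰₁ := by
      rw [Submodule.span_le]
      rintro _ ⟨i, rfl⟩
      fin_cases i
      · exact hB𝔰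
      · exact hy𝔰
      · exact hC𝔰
      · exact hL𝔰
    have h := Submodule.finrank_mono hle
    rw [finrank_span_eq_card hli, Fintype.card_fin] at h
    exact h
  -- the Jacobson clause leaves `𝔠 = 0`
  have h𝔠0 : 𝔠 = ⊥ := by
    rcases hclause with h | ⟨W, hW𝔠, -, -, hWdim⟩
    · exact h
    · exfalso
      have h := Submodule.finrank_mono hW𝔠
      omega
  rw [h𝔠0, sup_bot_eq] at hsup
  intro T hT hT0 hTad
  rw [← hsup] at hT ⊢
  exact hmin𝔰 T hT hT0 hTad

end HodgeStructure

end Literature.AlgebraicGeometry.Motives
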